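import Literature.MathematicalPhysics.QuantumFieldTheory.ConstructiveQFTWave0
import Summits.Ventures.YMGap.Thresholds.SinglePlaquetteSOS

/-!
# Venture YMGap — Theorem C, lattice part 1: plaquette Hessian form, corner terms, vertex inequality

HONEST FRAMING: venture file (cell `pub-ymgap`, track (a), item A2 = "Theorem C" of
`p2/HESSIAN-SHARP.md`, referee-checked inside the cell). This file sets up the LATTICE objects of
`p2/SPL-SOS.md` §3 on the discrete torus `(ℤ/L)^d` of `ConstructiveQFTWave0` (`Site`, `Edge`,
`Plaquette`, `Site.shift`, `GaugeConfig`; plaquette word in the order of `plaquetteHolonomy`) and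
proves the per-plaquette and per-vertex inequalities; the sum over the torus
(`hessianForm_le_four_d`) is in `HessianSharp.lean`. No measure, threshold or mass-gap statement
is made here.

* `plaqHess Q X x i j` — twice the second-order Taylor coefficient of `t ↦ Re tr hol_p(e^{tX}Q)`
  (`SinglePlaquetteSOS.word2` with `V = (X₁, X₂, -X₃, -X₄)`, `B = (Q₁, Q₂Q₃ᴴ, Q₄ᴴ, 1)`);
  `hessianForm = Σ_p plaqHess`, `tangentNormSq X = Σ_e ‖X_e‖²`.
* `endVec Q X v (i, s)` — the edge-end vectors `X̂_e(v)` (HESSIAN-SHARP §0): `X(v,i)` for the edge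
  starting at `v` in direction `i`, `-Q_eᴴX_eQ_e` for the edge `e = (v - eᵢ, i)` ending at `v`;
  `cornerSq` = `‖X̂_a(v) − X̂_b(v)‖²`, `siteCorner` = the four corner types of a direction pair.
* `plaqHess_le_corners` / `neg_plaqHess_le_corners` (Step A, SPL on the lattice, two-sided):
  `±plaqHess ≤` the four corner terms of the plaquette.
* `sum_orthPairs_le` (Step C): at a vertex, `Σ_{i<j} Σ_{s,s'} ‖f(i,s) − f(j,s')‖² ≤ 2d Σ_a ‖f a‖²`,
  from `Σ_{a,b} ‖x_a − x_b‖² = 2·#ι·Σ‖x_a‖² − 2‖Σ x_a‖²` (`sum_sum_frobSq_sub`).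

Reference: cell files `run/shared/lean/pub/pub-ymgap/p2/SPL-SOS.md` §3, `p2/HESSIAN-SHARP.md` §0–§3;
H. Shen, R. Zhu, X. Zhu, CMP 400 (2023) 805, Lemma 4.1.
-/

noncomputable section

namespace Summit.Ventures.YMGap.HessianSharp

open Matrix Complex Finset
open Literature.MathematicalPhysics.QuantumFieldTheory
open scoped Matrix ComplexConjugate BigOperators

variable {n : Type*} [Fintype n] [DecidableEq n]

/-! ## A vertex inequality: `Σ_{a,b} ‖x_a − x_b‖² ≤ 2·#ι·Σ_a ‖x_a‖²` -/

section Vertex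

variable {ι : Type*} [Fintype ι]

omit [DecidableEq n] in
/-- `Σ_a Σ_b ‖x_a − x_b‖² = 2·#ι·Σ_a ‖x_a‖² − 2 ‖Σ_a x_a‖²` for any finite family of square
matrices (expand the squares; the cross terms recombine into `‖Σ x‖²`). -/
theorem sum_sum_frobSq_sub (x : ι → Matrix n n ℂ) :
    ∑ a, ∑ b, frobSq (x a - x b) =
      2 * Fintype.card ι * ∑ a, frobSq (x a) - 2 * frobSq (∑ a, x a) := by
  have hcross : ∑ a, ∑ b, (x a * (x b)ᴴ).trace.re = frobSq (∑ a, x a) := by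
    unfold frobSq
    rw [conjTranspose_sum, Matrix.sum_mul, trace_sum, Complex.re_sum]
    refine Finset.sum_congr rfl fun a _ => ?_
    rw [Matrix.mul_sum, trace_sum, Complex.re_sum]
  have h1 : ∀ a, ∑ b, frobSq (x a - x b) =
      Fintype.card ι * frobSq (x a) + ∑ b, frobSq (x b) - 2 * ∑ b, (x a * (x b)ᴴ).trace.re := by
    intro a
    rw [Finset.mul_sum]
    simp_rw [frobSq_sub, Finset.sum_sub_distrib, Finset.sum_add_distrib, Finset.sum_const,
      Finset.card_univ, nsmul_eq_mul]
  simp_rw [h1, Finset.sum_sub_distrib, Finset.sum_add_distrib, ← Finset.mul_sum, hcross,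
    Finset.sum_const, Finset.card_univ, nsmul_eq_mul]
  ring

omit [DecidableEq n] in
/-- Dropping `‖Σ x‖² ≥ 0`: `Σ_a Σ_b ‖x_a − x_b‖² ≤ 2·#ι·Σ_a ‖x_a‖²`. -/
theorem sum_sum_frobSq_sub_le (x : ι → Matrix n n ℂ) :
    ∑ a, ∑ b, frobSq (x a - x b) ≤ 2 * Fintype.card ι * ∑ a, frobSq (x a) := by
  rw [sum_sum_frobSq_sub]
  linarith [frobSq_nonneg (∑ a, x a)]

omit [DecidableEq n] in
/-- **Orthogonal pairs at a vertex.** For a family `f` of matrices indexed by `Fin d × Bool`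
(the `2d` edge-ends at a lattice site: direction and forward/backward), the sum of
`‖f(i,s) − f(j,s')‖²` over pairs with DISTINCT directions `i < j` and all `s, s'` is at most
`2d · Σ_a ‖f a‖²` (it is half the sum over all ordered pairs minus the collinear and diagonal ones). -/
theorem sum_orthPairs_le (d : ℕ) (f : Fin d × Bool → Matrix n n ℂ) :
    ∑ i : Fin d, ∑ j : Fin d,
        (if i < j then ∑ s : Bool, ∑ s' : Bool, frobSq (f (i, s) - f (j, s')) else 0) ≤
      2 * d * ∑ a, frobSq (f a) := by
  set G : Fin d → Fin d → ℝ := fun i j => ∑ s : Bool, ∑ s' : Bool, frobSq (f (i, s) - f (j, s'))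
    with hG
  have Gsymm : ∀ i j, G i j = G j i := by
    intro i j
    simp only [hG]
    rw [Finset.sum_comm]
    refine Finset.sum_congr rfl fun s _ => Finset.sum_congr rfl fun s' _ => ?_
    rw [← frobSq_neg, neg_sub]
  have Gnn : ∀ i j, 0 ≤ G i j := fun i j =>
    Finset.sum_nonneg fun _ _ => Finset.sum_nonneg fun _ _ => frobSq_nonneg _
  -- the full ordered double sum
  have hall : ∑ a, ∑ b, frobSq (f a - f b) = ∑ i, ∑ j, G i j := by
    simp only [hG, Fintype.sum_prod_type]
    refine Finset.sum_congr rfl fun i _ => ?_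
    rw [Finset.sum_comm]
  -- twice the `i<j` part is at most the full sum
  have hhalf : 2 * ∑ i, ∑ j, (if i < j then G i j else 0) ≤ ∑ i, ∑ j, G i j := by
    have hswap : ∑ i : Fin d, ∑ j : Fin d, (if j < i then G i j else 0)
        = ∑ i : Fin d, ∑ j : Fin d, (if i < j then G i j else 0) := by
      rw [Finset.sum_comm]
      refine Finset.sum_congr rfl fun i _ => Finset.sum_congr rfl fun j _ => ?_
      rw [Gsymm j i]
    have hpt : ∀ i j : Fin d,
        (if i < j then G i j else 0) + (if j < i then G i j else 0) ≤ G i j := by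
      intro i j
      by_cases h1 : i < j
      · have h2 : ¬ j < i := not_lt.mpr (le_of_lt h1)
        simp [h1, h2]
      · by_cases h2 : j < i
        · simp [h1, h2]
        · simp [h1, h2, Gnn i j]
    calc 2 * ∑ i, ∑ j, (if i < j then G i j else 0)
        = ∑ i, ∑ j, (if i < j then G i j else 0) + ∑ i, ∑ j, (if j < i then G i j else 0) := by
          rw [hswap]; ring
      _ = ∑ i, ∑ j, ((if i < j then G i j else 0) + (if j < i then G i j else 0)) := by
          rw [← Finset.sum_add_distrib]
          refine Finset.sum_congr rfl fun i _ => ?_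
          rw [Finset.sum_add_distrib]
      _ ≤ ∑ i, ∑ j, G i j :=
          Finset.sum_le_sum fun i _ => Finset.sum_le_sum fun j _ => hpt i j
  have hcard : (Fintype.card (Fin d × Bool) : ℝ) = 2 * d := by
    rw [Fintype.card_prod, Fintype.card_fin, Fintype.card_bool]; push_cast; ring
  have hle := sum_sum_frobSq_sub_le f
  rw [hcard, hall] at hle
  have : ∑ i, ∑ j, (if i < j then G i j else 0)
      = ∑ i : Fin d, ∑ j : Fin d,
          (if i < j then ∑ s : Bool, ∑ s' : Bool, frobSq (f (i, s) - f (j, s')) else 0) := by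
    simp only [hG]
  rw [← this]
  linarith

end Vertex

/-! ## Four matrix identities: the corner squares of `word2_le_cornerSq` in lattice variables -/

section Corners

/-- Corner where edge 1 ends and edge 2 starts: `‖X₁ + Q₁X₂Q₁ᴴ‖² = ‖X₂ − (−Q₁ᴴX₁Q₁)‖²`. -/
theorem corner_bf (Q₁ X₁ X₂ : Matrix n n ℂ) (u : Q₁ᴴ * Q₁ = 1) (w : Q₁ * Q₁ᴴ = 1) :
    frobSq (X₁ + Q₁ * X₂ * Q₁ᴴ) = frobSq (X₂ - -(Q₁ᴴ * X₁ * Q₁)) := by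
  have c : ∀ M : Matrix n n ℂ, Q₁ᴴ * (Q₁ * M) = M := fun M => by
    rw [← Matrix.mul_assoc, u, Matrix.one_mul]
  have e : Q₁ᴴ * (X₁ + Q₁ * X₂ * Q₁ᴴ) * Q₁ = X₂ - -(Q₁ᴴ * X₁ * Q₁) := by
    simp only [Matrix.mul_add, Matrix.add_mul, Matrix.mul_assoc, c, u, Matrix.mul_one]
    abel
  rw [← frobSq_conj' Q₁ _ w, e]

/-- Corner where edges 2 and 3 both end:
`‖X₂ + (Q₂Q₃ᴴ)(−X₃)(Q₂Q₃ᴴ)ᴴ‖² = ‖−Q₂ᴴX₂Q₂ − (−Q₃ᴴX₃Q₃)‖²`. -/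
theorem corner_bb (Q₂ Q₃ X₂ X₃ : Matrix n n ℂ) (u : Q₂ᴴ * Q₂ = 1) (w : Q₂ * Q₂ᴴ = 1) :
    frobSq (X₂ + Q₂ * Q₃ᴴ * -X₃ * (Q₂ * Q₃ᴴ)ᴴ) =
      frobSq (-(Q₂ᴴ * X₂ * Q₂) - -(Q₃ᴴ * X₃ * Q₃)) := by
  have c : ∀ M : Matrix n n ℂ, Q₂ᴴ * (Q₂ * M) = M := fun M => by
    rw [← Matrix.mul_assoc, u, Matrix.one_mul]
  have e : Q₂ᴴ * (X₂ + Q₂ * Q₃ᴴ * -X₃ * (Q₂ * Q₃ᴴ)ᴴ) * Q₂ =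
      -(-(Q₂ᴴ * X₂ * Q₂) - -(Q₃ᴴ * X₃ * Q₃)) := by
    rw [conjTranspose_mul, conjTranspose_conjTranspose]
    simp only [Matrix.mul_add, Matrix.add_mul, Matrix.mul_neg, Matrix.neg_mul, Matrix.mul_assoc, c,
      u, Matrix.mul_one]
    abel
  rw [← frobSq_conj' Q₂ _ w, e, frobSq_neg]

omit [DecidableEq n] in
/-- Corner where edge 3 starts and edge 4 ends: `‖−X₃ + Q₄ᴴ(−X₄)Q₄‖² = ‖X₃ − (−Q₄ᴴX₄Q₄)‖²`. -/
theorem corner_fb (Q₄ X₃ X₄ : Matrix n n ℂ) :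
    frobSq (-X₃ + Q₄ᴴ * -X₄ * Q₄ᴴᴴ) = frobSq (X₃ - -(Q₄ᴴ * X₄ * Q₄)) := by
  have e : -X₃ + Q₄ᴴ * -X₄ * Q₄ᴴᴴ = -(X₃ - -(Q₄ᴴ * X₄ * Q₄)) := by
    rw [conjTranspose_conjTranspose]
    simp only [Matrix.mul_neg, Matrix.neg_mul]
    abel
  rw [e, frobSq_neg]

/-- Corner where edges 4 and 1 both start: `‖−X₄ + 1·X₁·1ᴴ‖² = ‖X₁ − X₄‖²`. -/
theorem corner_ff (X₁ X₄ : Matrix n n ℂ) :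
    frobSq (-X₄ + 1 * X₁ * (1 : Matrix n n ℂ)ᴴ) = frobSq (X₁ - X₄) := by
  rw [conjTranspose_one, Matrix.one_mul, Matrix.mul_one, neg_add_eq_sub]

/-- A member of the unitary group has its conjugate transpose in the unitary group. -/
theorem conjTranspose_mem_unitaryGroup {B : Matrix n n ℂ} (hB : B ∈ Matrix.unitaryGroup n ℂ) :
    Bᴴ ∈ Matrix.unitaryGroup n ℂ :=
  Unitary.star_mem hB

end Corners

/-! ## Lattice objects: the plaquette Hessian form and the edge-end vectors -/

variable {d L : ℕ}

/-- **The Hessian form of one plaquette** (twice the `t²`-Taylor coefficient of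
`t ↦ Re tr hol_p(e^{tX}Q)` for the plaquette `p = (x; i, j)`): with links
`Q₁ = Q(x,i), Q₂ = Q(x+eᵢ,j), Q₃ = Q(x+eⱼ,i), Q₄ = Q(x,j)` and `hol_p = Q₁Q₂Q₃⁻¹Q₄⁻¹`
(`plaquetteHolonomy`), the perturbed word is
`e^{tX₁}Q₁ · e^{tX₂}Q₂ · Q₃ᴴe^{-tX₃} · Q₄ᴴe^{-tX₄}`, i.e. `word2` with
`V = (X₁, X₂, -X₃, -X₄)`, `B = (Q₁, Q₂Q₃ᴴ, Q₄ᴴ, 1)` (for unitary links `Q⁻¹ = Qᴴ`). Summed over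
plaquettes and multiplied by `Nβ` this is the Hessian of the Wilson action `S = Nβ Σ_p Re tr hol_p`
in the direction `X` (Shen–Zhu–Zhu (4.3); that identification is NOT proved in this file). -/
def plaqHess (Q X : GaugeConfig d L (Matrix n n ℂ)) (x : Site d L) (i j : Fin d) : ℝ :=
  word2 (X (x, i)) (Q (x, i)) (X (x.shift i, j)) (Q (x.shift i, j) * (Q (x.shift j, i))ᴴ)
    (-X (x.shift j, i)) (Q (x, j))ᴴ (-X (x, j)) 1

/-- The total Hessian form `Σ_p plaqHess` over all plaquettes `p = (x; i<j)` of the torus. -/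
def hessianForm [NeZero L] (Q X : GaugeConfig d L (Matrix n n ℂ)) : ℝ :=
  ∑ p : Plaquette d L, plaqHess Q X p.1 p.2.1.1 p.2.1.2

/-- The squared norm `Σ_e ‖X_e‖²` of a family of link perturbations. -/
def tangentNormSq [NeZero L] (X : GaugeConfig d L (Matrix n n ℂ)) : ℝ :=
  ∑ e : Edge d L, frobSq (X e)

/-- **Edge-end vectors at a site** (`X̂_e(v)` of HESSIAN-SHARP §0): at the site `v`, the edge
`(v, i)` STARTS (`s = false`) and contributes `X(v,i)`; the edge `(v - eᵢ, i)` ENDS (`s = true`) and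
contributes `-Q_eᴴ X_e Q_e` (its perturbation seen from the far end of the link). -/
def endVec (Q X : GaugeConfig d L (Matrix n n ℂ)) (v : Site d L) : Fin d × Bool → Matrix n n ℂ
  | (i, false) => X (v, i)
  | (i, true) => -((Q (v - Pi.single i 1, i))ᴴ * X (v - Pi.single i 1, i) * Q (v - Pi.single i 1, i))

/-- The corner term `‖X̂_a(v) − X̂_b(v)‖²` for two edge-ends `a, b` at the site `v`. -/
def cornerSq (Q X : GaugeConfig d L (Matrix n n ℂ)) (v : Site d L) (a b : Fin d × Bool) : ℝ :=
  frobSq (endVec Q X v a - endVec Q X v b)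

/-- The four corner terms at the site `v` belonging to the direction pair `(i, j)`:
both-start, `j` starts/`i` ends, both end, `i` starts/`j` ends. -/
def siteCorner (Q X : GaugeConfig d L (Matrix n n ℂ)) (v : Site d L) (i j : Fin d) : ℝ :=
  cornerSq Q X v (i, false) (j, false) + cornerSq Q X v (j, false) (i, true)
    + cornerSq Q X v (j, true) (i, true) + cornerSq Q X v (i, false) (j, true)

omit [DecidableEq n] in
/-- Unfolding `endVec` at a forward end. -/
theorem endVec_false (Q X : GaugeConfig d L (Matrix n n ℂ)) (v : Site d L) (i : Fin d) :
    endVec Q X v (i, false) = X (v, i) := rfl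

omit [DecidableEq n] in
/-- The backward end of the edge `(x, i)` sits at `x + eᵢ`:
`X̂_{(x,i)}(x+eᵢ) = -Q(x,i)ᴴ X(x,i) Q(x,i)`. -/
theorem endVec_shift_true (Q X : GaugeConfig d L (Matrix n n ℂ)) (x : Site d L) (i : Fin d) :
    endVec Q X (x.shift i) (i, true) = -((Q (x, i))ᴴ * X (x, i) * Q (x, i)) := by
  simp only [endVec, Site.shift, add_sub_cancel_right]

omit [DecidableEq n] in
/-- The backward end of the edge `(x + eⱼ, i)` sits at `x + eᵢ + eⱼ`. -/
theorem endVec_shift_shift_true (Q X : GaugeConfig d L (Matrix n n ℂ)) (x : Site d L)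
    (i j : Fin d) :
    endVec Q X ((x.shift i).shift j) (i, true) =
      -((Q (x.shift j, i))ᴴ * X (x.shift j, i) * Q (x.shift j, i)) := by
  -- shifts commute (`WilsonRP.shift_comm` in `ConstructiveQFTWave0Proofs`; re-proved inline to keep
  -- this file's imports light)
  rw [show (x.shift i).shift j = (x.shift j).shift i by simp only [Site.shift, add_right_comm],
    endVec_shift_true]

/-! ## Step A: one plaquette is bounded by its four corners -/

/-- **SPL on the lattice.** For unitary links, the Hessian form of the plaquette `(x; i, j)` is at
most the sum of its four corner terms: at `x` (both edges start), at `x+eᵢ` (`(x,i)` ends, `(x+eᵢ,j)`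
starts), at `x+eᵢ+eⱼ` (both end), at `x+eⱼ` (`(x+eⱼ,i)` starts, `(x,j)` ends). -/
theorem plaqHess_le_corners (Q X : GaugeConfig d L (Matrix n n ℂ))
    (hQ : ∀ e, Q e ∈ Matrix.unitaryGroup n ℂ) (x : Site d L) (i j : Fin d) :
    plaqHess Q X x i j ≤
      cornerSq Q X x (i, false) (j, false)
      + cornerSq Q X (x.shift i) (j, false) (i, true)
      + cornerSq Q X ((x.shift i).shift j) (j, true) (i, true)
      + cornerSq Q X (x.shift j) (i, false) (j, true) := by
  have u₁ := conjTranspose_mul_self_of_mem (hQ (x, i))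
  have w₁ := mul_conjTranspose_self_of_mem (hQ (x, i))
  have u₂ := conjTranspose_mul_self_of_mem (hQ (x.shift i, j))
  have w₂ := mul_conjTranspose_self_of_mem (hQ (x.shift i, j))
  have hB₂ : Q (x.shift i, j) * (Q (x.shift j, i))ᴴ ∈ Matrix.unitaryGroup n ℂ :=
    Submonoid.mul_mem _ (hQ _) (conjTranspose_mem_unitaryGroup (hQ _))
  have hB₃ : (Q (x, j))ᴴ ∈ Matrix.unitaryGroup n ℂ := conjTranspose_mem_unitaryGroup (hQ _)
  have hB₄ : (1 : Matrix n n ℂ) ∈ Matrix.unitaryGroup n ℂ := Submonoid.one_mem _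
  have spl := word2_le_cornerSq (X (x, i)) (Q (x, i)) (X (x.shift i, j))
    (Q (x.shift i, j) * (Q (x.shift j, i))ᴴ) (-X (x.shift j, i)) (Q (x, j))ᴴ (-X (x, j)) 1
    (hQ _) hB₂ hB₃ hB₄
  rw [corner_bf _ _ _ u₁ w₁, corner_bb _ _ _ _ u₂ w₂, corner_fb, corner_ff] at spl
  rw [plaqHess]
  simp only [cornerSq, endVec_false, endVec_shift_true, endVec_shift_shift_true]
  linarith [spl]

omit [DecidableEq n] in
/-- `word2` is linear in the constant `B₁`: flipping its sign flips the sign of `word2`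
(every monomial contains `B₁` exactly once). -/
theorem word2_neg_left (V₁ B₁ V₂ B₂ V₃ B₃ V₄ B₄ : Matrix n n ℂ) :
    word2 V₁ (-B₁) V₂ B₂ V₃ B₃ V₄ B₄ = -word2 V₁ B₁ V₂ B₂ V₃ B₃ V₄ B₄ := by
  unfold word2
  simp only [Matrix.neg_mul, Matrix.mul_neg, trace_neg, ← Complex.neg_re]
  congr 1
  ring

/-- The unitary group is closed under `B ↦ -B`. -/
theorem neg_mem_unitaryGroup {B : Matrix n n ℂ} (hB : B ∈ Matrix.unitaryGroup n ℂ) :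
    -B ∈ Matrix.unitaryGroup n ℂ := by
  rw [Matrix.mem_unitaryGroup_iff] at hB ⊢
  rw [star_neg, neg_mul_neg, hB]

/-- **Two-sidedness** (HESSIAN-SHARP §7(b)): also `-plaqHess` is bounded by the same four corner
terms (apply the SPL with the first link negated, `-Q₁ ∈ U(n)`). -/
theorem neg_plaqHess_le_corners (Q X : GaugeConfig d L (Matrix n n ℂ))
    (hQ : ∀ e, Q e ∈ Matrix.unitaryGroup n ℂ) (x : Site d L) (i j : Fin d) :
    -plaqHess Q X x i j ≤
      cornerSq Q X x (i, false) (j, false)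
      + cornerSq Q X (x.shift i) (j, false) (i, true)
      + cornerSq Q X ((x.shift i).shift j) (j, true) (i, true)
      + cornerSq Q X (x.shift j) (i, false) (j, true) := by
  have u₁ := conjTranspose_mul_self_of_mem (hQ (x, i))
  have w₁ := mul_conjTranspose_self_of_mem (hQ (x, i))
  have u₂ := conjTranspose_mul_self_of_mem (hQ (x.shift i, j))
  have w₂ := mul_conjTranspose_self_of_mem (hQ (x.shift i, j))
  have hB₂ : Q (x.shift i, j) * (Q (x.shift j, i))ᴴ ∈ Matrix.unitaryGroup n ℂ :=
    Submonoid.mul_mem _ (hQ _) (conjTranspose_mem_unitaryGroup (hQ _))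
  have hB₃ : (Q (x, j))ᴴ ∈ Matrix.unitaryGroup n ℂ := conjTranspose_mem_unitaryGroup (hQ _)
  have hB₄ : (1 : Matrix n n ℂ) ∈ Matrix.unitaryGroup n ℂ := Submonoid.one_mem _
  have spl := word2_le_cornerSq (X (x, i)) (-Q (x, i)) (X (x.shift i, j))
    (Q (x.shift i, j) * (Q (x.shift j, i))ᴴ) (-X (x.shift j, i)) (Q (x, j))ᴴ (-X (x, j)) 1
    (neg_mem_unitaryGroup (hQ _)) hB₂ hB₃ hB₄
  rw [word2_neg_left, conjTranspose_neg, Matrix.neg_mul, neg_mul_neg,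
    corner_bf _ _ _ u₁ w₁, corner_bb _ _ _ _ u₂ w₂, corner_fb, corner_ff] at spl
  rw [plaqHess]
  simp only [cornerSq, endVec_false, endVec_shift_true, endVec_shift_shift_true]
  linarith [spl]

end Summit.Ventures.YMGap.HessianSharp
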